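import Literature.Analysis.Complex.HartmanWintnerBootstrap
import Mathlib.Analysis.SpecificLimits.Basic
import Mathlib.Analysis.Calculus.BumpFunction.InnerProduct
import HarnessLib

/-!
# The Hartman–Wintner theorem for `|∂̄w| ≤ K|w|`: zeros of finite order or `w ≡ 0`

Let `F` be a complex Banach space and `w : B(c, r) → F` a `C¹` map with `‖∂̄w‖ ≤ K ‖w‖`
(`∂̄ = Literature.Analysis.Complex.dbarAlong 1 = ½(∂ₓ + i∂_y)`) and `w c = 0`. Then EITHER `w`
vanishes identically near `c`, OR `c` is an isolated zero of `w`
(`hartmanWintner_zero_dichotomy`). This is the zero-set half of the theorem of Hartman and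
Wintner (1953) on the local behaviour of solutions of such differential inequalities (the other
half being the asymptotics `w(z) = a (z - c)^k + o(|z - c|^k)`, which the proof produces on the
way: `tendsto_pow_inv_smul`), equivalently of the Carleman–Bers–Vekua similarity principle in the
form "solutions of `∂̄w + Aw = 0`, `A ∈ L^∞`, have isolated zeros unless `≡ 0`" (Wendl, *Lectures
on holomorphic curves*, Thm 2.50; McDuff–Salamon 2012, §2.3). It is proved here for `C¹` and
vector-valued `w` by Hartman–Wintner's elementary method (Schulz (1990), §7.1, Thm 7.1.1), for
which the tree's compact-support Cauchy–Pompeiu formula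
(`Literature.Analysis.Complex.integral_inv_smul_dbarAlong_sub`) is all the complex analysis
needed — as opposed to the `W^{1,p}`/Calderón–Zygmund route of Wendl's proof, or the scalar
`C^∞` similarity engine of `Literature/Analysis/Complex/SimilarityPrinciple.lean`.

## The argument (at `c = 0`; notation of `HartmanWintnerBootstrap.lean`, `φ = χ • w`)

Stage `k` consists of the qualitative bound `w = O(|z|^{k-1})` and the representation
`(R_k)  π ζ^{-k} w(ζ) = G_k(ζ) := ∫ (ζ - z)⁻¹ f_k(z) dA(z)`, `f_k = z^{-k} ∂̄φ`, on `0 < |ζ| ≤ ρₘ`.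
* `(R_0)` is Cauchy–Pompeiu (`representation_zero`).
* At stage `k` the bootstrap (`HartmanWintner.norm_le_of_stage`) gives `‖w‖ ≤ A ρₘ^{-k} |z|^k`
  with `A = 4(ρ+ρₘ)(L+K)m` independent of `k`; hence `f_k` is bounded, `G_k` is continuous at
  `0` (`PlanePotentialEstimates.continuousAt_integral_inv_sub_smul`) and
  `ζ^{-k} w(ζ) → a_k := π⁻¹ G_k(0)` (`tendsto_pow_inv_smul`).
* If `a_k ≠ 0`, `0` is an isolated zero. If `a_k = 0`, the partial fraction
  `1/((ζ-z) z^{k+1}) = ζ⁻¹ (1/((ζ-z)z^k) + 1/z^{k+1})` and `∫ z^{-(k+1)} ∂̄φ = -G_k(0) = 0` give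
  `(R_{k+1})` (`representation_succ`), and the stage-`k` bound gives `O(|z|^k)`.
* If no `a_k` is nonzero, `‖w(ζ)‖ ≤ A (|ζ|/ρₘ)^k` for all `k`, so `w ≡ 0` on `B(0, ρₘ)`.

## References

* P. Hartman, A. Wintner, *On the local behavior of solutions of non-parabolic partial
  differential equations*, Amer. J. Math. 75 (1953), 449–476 (the lemma on pp. 455–458, as
  reproduced in J. Jost, *Harmonic maps between surfaces*, LNM 1062 (1984), §3.9 Lemma 3.6).
  [HartmanWintner1953]
* F. Schulz, *Regularity theory for quasilinear elliptic systems and Monge–Ampère equations in two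
  dimensions*, Springer LNM 1445 (1990), §7.1, Thm 7.1.1 ("Carleman–Hartman–Wintner theorem";
  held text, pp. 59–61). [SchulzRegularity1990]
* C. Wendl, *Lectures on Holomorphic Curves in Symplectic and Contact Geometry*, arXiv:1011.1690,
  §2.7, Thm 2.50. [WendlLectures2010]
-/

noncomputable section

open MeasureTheory Metric Set Filter Topology Complex
open scoped Real ContDiff

namespace Literature.Analysis.Complex

namespace HartmanWintner

variable {F : Type*} [NormedAddCommGroup F] [NormedSpace ℂ F]
variable {w : ℂ → F} {χ : ℂ → ℂ} {K L m r ρ ρm : ℝ}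
variable (hρm : 0 < ρm) (hρ : ρm < ρ) (hr : ρ < r) (hw : ContDiffOn ℝ 1 w (ball 0 r))
  (hK : 0 ≤ K) (hdbar : ∀ z ∈ ball (0 : ℂ) r, ‖dbarAlong 1 w z‖ ≤ K * ‖w z‖)
  (hχ : ContDiff ℝ 1 χ) (hχ1 : ∀ z : ℂ, ‖z‖ ≤ ρm → χ z = 1) (hχs : tsupport χ ⊆ ball 0 ρ)
  (hχle : ∀ z, ‖χ z‖ ≤ 1) (hL : 0 ≤ L) (hLχ : ∀ z, ‖dbarAlong 1 χ z‖ ≤ L)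
  (hm : 0 ≤ m) (hmw : ∀ z : ℂ, ‖z‖ < ρ → ‖w z‖ ≤ m)

/-! ### Stage 0: the Cauchy–Pompeiu representation -/

include hr hw hχ hχ1 hχs in
/-- **`(R_0)`**: `π w(ζ) = ∫ (ζ - z)⁻¹ ∂̄φ(z) dA(z)` for `|ζ| ≤ ρₘ` — the Cauchy–Pompeiu formula for
`φ = χ • w ∈ C¹_c` after the change of variables `t = ζ - z` (written with the factors
`(ζ^0)⁻¹ = (z^0)⁻¹ = 1` of the general stage). [cite: SchulzRegularity1990, §7.1 (7.5)] -/
theorem representation_zero [CompleteSpace F] {ζ : ℂ} (hζ : ‖ζ‖ ≤ ρm) :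
    ((π : ℂ) * (ζ ^ 0)⁻¹) • w ζ =
      ∫ z, (ζ - z)⁻¹ • ((z ^ 0)⁻¹ • dbarAlong 1 (fun y => χ y • w y) z) := by
  have hCP := integral_inv_smul_dbarAlong_sub (contDiff_phi hr hw hχ hχs)
    (hasCompactSupport_phi hχs) ζ
  have hcv := integral_sub_left_eq_self
    (fun z => (↑π * (ζ - z))⁻¹ • dbarAlong 1 (fun y => χ y • w y) z) volume ζ
  simp only [sub_sub_cancel] at hcv
  rw [hcv] at hCP
  simp only [pow_zero, inv_one, mul_one, one_smul]
  rw [hχ1 ζ hζ, one_smul] at hCP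
  rw [← hCP, ← integral_smul]
  refine integral_congr_ae (Eventually.of_forall fun z => ?_)
  dsimp only
  rw [smul_smul, mul_inv, ← mul_assoc, mul_inv_cancel₀ (ofReal_ne_zero.2 Real.pi_pos.ne'),
    one_mul]

/-! ### The limit `a_k = lim ζ^{-k} w(ζ)` -/

include hρm hρ hr hw hK hdbar hχ hχ1 hχs hχle hL hLχ hm hmw in
/-- **Existence of `lim_{ζ → 0} ζ^{-k} w(ζ)`** (Hartman–Wintner; Schulz (1990), Thm 7.1.1): under
`(R_k)` and the order-`k` bound `‖w z‖ ≤ A |z|^k` on `B̄(0, ρₘ)`, `ζ^{-k} w(ζ) → π⁻¹ G_k(0)` as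
`ζ → 0`, `ζ ≠ 0`, where `G_k(ζ) = ∫ (ζ - z)⁻¹ z^{-k} ∂̄φ(z) dA(z)`. [cite: SchulzRegularity1990, §7.1 Thm 7.1.1] -/
theorem tendsto_pow_inv_smul (k : ℕ) {A : ℝ} (hA : 0 ≤ A)
    (hwA : ∀ z : ℂ, ‖z‖ ≤ ρm → ‖w z‖ ≤ A * ‖z‖ ^ k)
    (hR : ∀ ζ : ℂ, 0 < ‖ζ‖ → ‖ζ‖ ≤ ρm → ((π : ℂ) * (ζ ^ k)⁻¹) • w ζ =
      ∫ z, (ζ - z)⁻¹ • ((z ^ k)⁻¹ • dbarAlong 1 (fun y => χ y • w y) z)) :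
    Tendsto (fun ζ : ℂ => (ζ ^ k)⁻¹ • w ζ) (𝓝[≠] 0)
      (𝓝 ((π : ℂ)⁻¹ • ∫ z, ((0 : ℂ) - z)⁻¹ • ((z ^ k)⁻¹ • dbarAlong 1 (fun y => χ y • w y) z))) := by
  set f : ℂ → F := fun z => (z ^ k)⁻¹ • dbarAlong 1 (fun y => χ y • w y) z with hf
  have hGc : ContinuousAt (fun ζ : ℂ => ∫ z, (ζ - z)⁻¹ • f z) 0 :=
    continuousAt_integral_inv_sub_smul (aestronglyMeasurable_density hr hw hχ hχs k)
      (norm_density_le hρ hr hw hχ hχs hρm hK hdbar hχ1 hχle hL hLχ hm hmw k hA hwA)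
      (density_support hχs k) 0
  have h1 : Tendsto (fun ζ : ℂ => (π : ℂ)⁻¹ • ∫ z, (ζ - z)⁻¹ • f z) (𝓝[≠] 0)
      (𝓝 ((π : ℂ)⁻¹ • ∫ z, ((0 : ℂ) - z)⁻¹ • f z)) :=
    (hGc.tendsto.mono_left nhdsWithin_le_nhds).const_smul _
  refine h1.congr' ?_
  have hmem : {(0 : ℂ)}ᶜ ∩ ball (0 : ℂ) ρm ∈ 𝓝[≠] (0 : ℂ) :=
    inter_mem_nhdsWithin _ (ball_mem_nhds 0 hρm)
  filter_upwards [hmem] with ζ hζ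
  have hζ0 : 0 < ‖ζ‖ := norm_pos_iff.2 (mem_compl_singleton_iff.1 hζ.1)
  rw [← hR ζ hζ0 (mem_ball_zero_iff.1 hζ.2).le, smul_smul, ← mul_assoc,
    inv_mul_cancel₀ (ofReal_ne_zero.2 Real.pi_pos.ne'), one_mul]

/-! ### From stage `k` to stage `k + 1` -/

include hρm hρ hr hw hK hdbar hχ hχ1 hχs hχle hL hLχ hm hmw in
/-- **`(R_k) ⇒ (R_{k+1})` when `a_k = 0`**: if `G_k(0) = 0` then
`π ζ^{-(k+1)} w(ζ) = ∫ (ζ - z)⁻¹ z^{-(k+1)} ∂̄φ(z) dA(z)` on `0 < |ζ| ≤ ρₘ`, by the partial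
fraction `1/((ζ - z) z^{k+1}) = ζ⁻¹ (1/((ζ - z) z^k) - 1/((0 - z) z^k))`. [cite: SchulzRegularity1990, §7.1 Thm 7.1.1] -/
theorem representation_succ (k : ℕ) {A : ℝ} (hA : 0 ≤ A)
    (hwA : ∀ z : ℂ, ‖z‖ ≤ ρm → ‖w z‖ ≤ A * ‖z‖ ^ k)
    (hR : ∀ ζ : ℂ, 0 < ‖ζ‖ → ‖ζ‖ ≤ ρm → ((π : ℂ) * (ζ ^ k)⁻¹) • w ζ =
      ∫ z, (ζ - z)⁻¹ • ((z ^ k)⁻¹ • dbarAlong 1 (fun y => χ y • w y) z))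
    (hG0 : ∫ z, ((0 : ℂ) - z)⁻¹ • ((z ^ k)⁻¹ • dbarAlong 1 (fun y => χ y • w y) z) = 0)
    {ζ : ℂ} (hζ0 : 0 < ‖ζ‖) (hζ : ‖ζ‖ ≤ ρm) :
    ((π : ℂ) * (ζ ^ (k + 1))⁻¹) • w ζ =
      ∫ z, (ζ - z)⁻¹ • ((z ^ (k + 1))⁻¹ • dbarAlong 1 (fun y => χ y • w y) z) := by
  set f : ℂ → F := fun z => (z ^ k)⁻¹ • dbarAlong 1 (fun y => χ y • w y) z with hf
  have hfm := aestronglyMeasurable_density hr hw hχ hχs k (w := w)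
  have hfb := norm_density_le hρ hr hw hχ hχs hρm hK hdbar hχ1 hχle hL hLχ hm hmw k hA hwA
  have hfs := density_support hχs k (w := w)
  have hint : ∀ η : ℂ, Integrable fun z => (η - z)⁻¹ • f z := fun η =>
    integrable_inv_sub_smul hfm hfb hfs η
  have hζne : ζ ≠ 0 := norm_pos_iff.1 hζ0
  -- the integrand of `G_{k+1}` a.e. equals `ζ⁻¹ • ((ζ - z)⁻¹ • f z - (0 - z)⁻¹ • f z)`
  have hae : (fun z : ℂ => (ζ - z)⁻¹ • ((z ^ (k + 1))⁻¹ • dbarAlong 1 (fun y => χ y • w y) z))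
      =ᵐ[volume] fun z => ζ⁻¹ • ((ζ - z)⁻¹ • f z - ((0 : ℂ) - z)⁻¹ • f z) := by
    have h0 : ∀ᵐ z : ℂ ∂volume, z ≠ 0 := compl_mem_ae_iff.2 (measure_singleton (0 : ℂ))
    have h1 : ∀ᵐ z : ℂ ∂volume, z ≠ ζ := compl_mem_ae_iff.2 (measure_singleton ζ)
    filter_upwards [h0, h1] with z hz0 hzζ
    have hzζ' : ζ - z ≠ 0 := sub_ne_zero.2 (Ne.symm hzζ)
    simp only [hf, smul_smul, ← sub_smul]
    congr 1
    rw [zero_sub, inv_neg, pow_succ]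
    field_simp
    ring
  rw [integral_congr_ae hae, integral_smul, integral_sub (hint ζ) (hint 0), hG0, sub_zero,
    ← hR ζ hζ0 hζ, smul_smul]
  congr 1
  rw [pow_succ]
  field_simp

/-! ### The dichotomy at the origin -/

include hρm hρ hr hw hK hdbar hχ hχ1 hχs hχle hL hLχ hm hmw in
/-- **Hartman–Wintner dichotomy at the origin, with the cut-off data explicit.** In the setting
of `HartmanWintnerBootstrap.lean`, if `16 ρₘ K ≤ 1` and `w 0 = 0`, then either `w = 0` near `0` or
`w ≠ 0` on a punctured neighbourhood of `0`. [cite: HartmanWintner1953, pp. 455–458] -/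
theorem eventually_eq_zero_or_eventually_ne_zero [CompleteSpace F] (hsmall : 16 * ρm * K ≤ 1) (hw0 : w 0 = 0) :
    (∀ᶠ z in 𝓝 (0 : ℂ), w z = 0) ∨ (∀ᶠ z in 𝓝[≠] (0 : ℂ), w z ≠ 0) := by
  by_cases hiso : ∀ᶠ z in 𝓝[≠] (0 : ℂ), w z ≠ 0
  · exact Or.inr hiso
  left
  set A : ℝ := 4 * (ρ + ρm) * (L + K) * m with hA_def
  have hρ0 : 0 < ρ := hρm.trans hρ
  have hA : 0 ≤ A := by rw [hA_def]; positivity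
  -- every stage holds, and every limit `a_k` vanishes
  have key : ∀ k : ℕ,
      (∃ M : ℝ, ∀ z : ℂ, ‖z‖ ≤ ρm → ‖z‖ * ‖w z‖ ≤ M * ‖z‖ ^ k) ∧
      (∀ ζ : ℂ, 0 < ‖ζ‖ → ‖ζ‖ ≤ ρm → ((π : ℂ) * (ζ ^ k)⁻¹) • w ζ =
        ∫ z, (ζ - z)⁻¹ • ((z ^ k)⁻¹ • dbarAlong 1 (fun y => χ y • w y) z)) := by
    intro k
    induction k with
    | zero =>
      refine ⟨⟨ρm * m, fun z hz => ?_⟩, fun ζ _ hζ => representation_zero hr hw hχ hχ1 hχs hζ⟩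
      rw [pow_zero, mul_one]
      exact mul_le_mul hz (hmw z (by linarith)) (norm_nonneg _) hρm.le
    | succ k ih =>
      have hbd : ∀ z : ℂ, ‖z‖ ≤ ρm → ‖w z‖ ≤ A * (ρm ^ k)⁻¹ * ‖z‖ ^ k := by
        intro z hz
        by_cases hz0 : z = 0
        · rw [hz0, hw0, norm_zero]
          positivity
        · exact norm_le_of_stage hρm hρ hr hw hK hdbar hχ hχ1 hχs hχle hL hLχ hm hmw k hsmall
            ih.1 ih.2 (norm_pos_iff.2 hz0) hz
      have hA' : 0 ≤ A * (ρm ^ k)⁻¹ := by positivity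
      have hG0 : ∫ z, ((0 : ℂ) - z)⁻¹ • ((z ^ k)⁻¹ • dbarAlong 1 (fun y => χ y • w y) z) = 0 := by
        by_contra hne
        apply hiso
        have ht := tendsto_pow_inv_smul hρm hρ hr hw hK hdbar hχ hχ1 hχs hχle hL hLχ hm hmw k
          hA' hbd ih.2
        have hlim : (π : ℂ)⁻¹ • (∫ z, ((0 : ℂ) - z)⁻¹ •
            ((z ^ k)⁻¹ • dbarAlong 1 (fun y => χ y • w y) z)) ≠ 0 :=
          smul_ne_zero (inv_ne_zero (ofReal_ne_zero.2 Real.pi_pos.ne')) hne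
        filter_upwards [ht.eventually (isOpen_ne.mem_nhds hlim)] with ζ hζ hwζ
        exact hζ (by rw [hwζ, smul_zero])
      refine ⟨⟨A * (ρm ^ k)⁻¹, fun z hz => ?_⟩, fun ζ hζ0 hζ =>
        representation_succ hρm hρ hr hw hK hdbar hχ hχ1 hχs hχle hL hLχ hm hmw k hA' hbd ih.2
          hG0 hζ0 hζ⟩
      calc ‖z‖ * ‖w z‖ ≤ ‖z‖ * (A * (ρm ^ k)⁻¹ * ‖z‖ ^ k) :=
            mul_le_mul_of_nonneg_left (hbd z hz) (norm_nonneg _)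
        _ = A * (ρm ^ k)⁻¹ * ‖z‖ ^ (k + 1) := by ring
  -- flatness with `k`-independent constant forces `w ≡ 0` on `B(0, ρₘ)`
  have hflat : ∀ (k : ℕ) (ζ : ℂ), 0 < ‖ζ‖ → ‖ζ‖ ≤ ρm → ‖w ζ‖ ≤ A * (‖ζ‖ / ρm) ^ k := by
    intro k ζ hζ0 hζ
    have h := norm_le_of_stage hρm hρ hr hw hK hdbar hχ hχ1 hχs hχle hL hLχ hm hmw k hsmall
      (key k).1 (key k).2 hζ0 hζ
    calc ‖w ζ‖ ≤ 4 * (ρ + ρm) * (L + K) * m * (ρm ^ k)⁻¹ * ‖ζ‖ ^ k := h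
      _ = A * (‖ζ‖ / ρm) ^ k := by rw [hA_def, div_pow]; ring
  filter_upwards [ball_mem_nhds (0 : ℂ) hρm] with ζ hζ
  by_cases hζ0 : ζ = 0
  · rw [hζ0, hw0]
  have hζ' := mem_ball_zero_iff.1 hζ
  have ht1 : ‖ζ‖ / ρm < 1 := (div_lt_one hρm).2 hζ'
  have ht0 : 0 ≤ ‖ζ‖ / ρm := by positivity
  have hlim : Tendsto (fun k : ℕ => A * (‖ζ‖ / ρm) ^ k) atTop (𝓝 0) := by
    simpa using (tendsto_pow_atTop_nhds_zero_of_lt_one ht0 ht1).const_mul A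
  have hle : ‖w ζ‖ ≤ 0 :=
    ge_of_tendsto' hlim fun k => hflat k ζ (norm_pos_iff.2 hζ0) hζ'.le
  exact norm_le_zero_iff.1 hle

end HartmanWintner

/-! ### The theorem, for a disc with arbitrary centre -/

/-- A `C¹` cut-off on `ℂ` (from Mathlib's `ContDiffBump`): `χ = 1` on `B̄(0, ρₘ)`,
`tsupport χ ⊆ B̄(0, ρ)`, `‖χ‖ ≤ 1`, compactly supported. [folklore] -/
theorem HartmanWintner.exists_cutoff {ρm ρ : ℝ} (h0 : 0 < ρm) (h1 : ρm < ρ) :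
    ∃ χ : ℂ → ℂ, ContDiff ℝ 1 χ ∧ HasCompactSupport χ ∧ (∀ z : ℂ, ‖z‖ ≤ ρm → χ z = 1) ∧
      tsupport χ ⊆ closedBall 0 ρ ∧ ∀ z, ‖χ z‖ ≤ 1 := by
  let χ₀ : ContDiffBump (0 : ℂ) := ⟨ρm, ρ, h0, h1⟩
  refine ⟨fun z => ((χ₀ z : ℝ) : ℂ), ofRealCLM.contDiff.comp χ₀.contDiff,
    χ₀.hasCompactSupport.comp_left ofReal_zero, fun z hz => ?_, ?_, fun z => ?_⟩
  · show ((χ₀ z : ℝ) : ℂ) = 1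
    rw [χ₀.one_of_mem_closedBall (mem_closedBall_zero_iff.2 hz), ofReal_one]
  · refine (closure_mono (Function.support_comp_subset ofReal_zero χ₀)).trans ?_
    rw [← tsupport, χ₀.tsupport_eq]
  · show ‖((χ₀ z : ℝ) : ℂ)‖ ≤ 1
    rw [norm_real, Real.norm_of_nonneg χ₀.nonneg]
    exact χ₀.le_one

open HartmanWintner in
/-- **Hartman–Wintner theorem (zero dichotomy for `|∂̄w| ≤ K|w|`).** Let `F` be a complex Banach
space, `w : ℂ → F` of class `C¹` on the disc `B(c, r)` with `‖∂̄w(z)‖ ≤ K ‖w(z)‖` there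
(`∂̄ = dbarAlong 1 = ½(∂ₓ + i∂_y)`), and `w c = 0`. Then either `w = 0` on a neighbourhood of `c`,
or `w z ≠ 0` for all `z ≠ c` near `c`. (Hartman–Wintner (1953); Schulz (1990), Thm 7.1.1; the
zero-set statement of the similarity principle, Wendl, Lectures, Thm 2.50.)
[cite: HartmanWintner1953, pp. 455–458] -/
theorem hartmanWintner_zero_dichotomy {F : Type*} [NormedAddCommGroup F] [NormedSpace ℂ F]
    [CompleteSpace F] {w : ℂ → F} {c : ℂ} {r K : ℝ} (hr : 0 < r)
    (hw : ContDiffOn ℝ 1 w (ball c r))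
    (hdbar : ∀ z ∈ ball c r, ‖dbarAlong 1 w z‖ ≤ K * ‖w z‖) (hw0 : w c = 0) :
    (∀ᶠ z in 𝓝 c, w z = 0) ∨ (∀ᶠ z in 𝓝[≠] c, w z ≠ 0) := by
  -- translate to the origin and make the constant nonnegative
  set K' : ℝ := max K 0 with hK'
  have hK'0 : 0 ≤ K' := le_max_right _ _
  set v : ℂ → F := fun z => w (z + c) with hv
  have hv_diff : ContDiffOn ℝ 1 v (ball 0 r) := by
    refine hw.comp (contDiffOn_id.add contDiffOn_const) fun z hz => ?_
    rw [mem_ball_zero_iff] at hz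
    simpa [mem_ball_iff_norm] using hz
  have hv_dbar : ∀ z ∈ ball (0 : ℂ) r, ‖dbarAlong 1 v z‖ ≤ K' * ‖v z‖ := by
    intro z hz
    have hzc : z + c ∈ ball c r := by
      rw [mem_ball_zero_iff] at hz
      simpa [mem_ball_iff_norm] using hz
    have he : dbarAlong 1 v z = dbarAlong 1 w (z + c) := by
      rw [dbarAlong_apply, dbarAlong_apply, hv, fderiv_comp_add_right]
    rw [he]
    exact (hdbar _ hzc).trans (mul_le_mul_of_nonneg_right (le_max_left _ _) (norm_nonneg _))
  have hv0 : v 0 = 0 := by simp [hv, hw0]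
  -- radii: `ρ = r/2`, `ρₘ ≤ r/4` with `16 ρₘ K' ≤ 1`
  set ρ : ℝ := r / 2 with hρ_def
  set ρm : ℝ := min (r / 4) (1 / (16 * K' + 1)) with hρm_def
  have hρm0 : 0 < ρm := lt_min (by positivity) (by positivity)
  have hρmρ : ρm < ρ := (min_le_left _ _).trans_lt (by rw [hρ_def]; linarith)
  have hρr : ρ < r := by rw [hρ_def]; linarith
  have hsmall : 16 * ρm * K' ≤ 1 := by
    have h1 : ρm ≤ 1 / (16 * K' + 1) := min_le_right _ _
    have h2 : ρm * (16 * K' + 1) ≤ 1 := by rwa [le_div_iff₀ (by positivity)] at h1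
    nlinarith
  -- the cut-off
  obtain ⟨χ, hχ', hχc, hχ1, hχ0, hχle⟩ :=
    HartmanWintner.exists_cutoff (ρm := ρm) (ρ := (ρm + ρ) / 2) hρm0 (by linarith)
  have hχs : tsupport χ ⊆ ball 0 ρ :=
    hχ0.trans (closedBall_subset_ball (by linarith : (ρm + ρ) / 2 < ρ))
  obtain ⟨L₀, hL₀⟩ := (continuous_dbarAlong hχ' 1).bounded_above_of_compact_support
    (hasCompactSupport_dbarAlong hχc 1)
  set L : ℝ := max L₀ 0 with hL_def
  have hLχ : ∀ z, ‖dbarAlong 1 χ z‖ ≤ L := fun z => (hL₀ z).trans (le_max_left _ _)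
  -- the sup of `‖v‖` on `B̄(0, ρ)`
  obtain ⟨m₀, hm₀⟩ := (isCompact_closedBall (0 : ℂ) ρ).exists_bound_of_continuousOn
    (hv_diff.continuousOn.mono (closedBall_subset_ball hρr))
  set m : ℝ := max m₀ 0 with hm_def
  have hmw : ∀ z : ℂ, ‖z‖ < ρ → ‖v z‖ ≤ m := fun z hz =>
    (hm₀ z (mem_closedBall_zero_iff.2 hz.le)).trans (le_max_left _ _)
  -- the dichotomy for `v` at `0`
  have key := eventually_eq_zero_or_eventually_ne_zero hρm0 hρmρ hρr hv_diff hK'0 hv_dbar hχ'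
    hχ1 hχs hχle (le_max_right L₀ 0) hLχ (le_max_right m₀ 0) hmw hsmall hv0
  -- translate back
  have ht : Tendsto (fun z : ℂ => z - c) (𝓝 c) (𝓝 0) := by
    have := (continuous_sub_right c).tendsto c
    rwa [sub_self] at this
  rcases key with h | h
  · left
    have := ht.eventually h
    filter_upwards [this] with z hz
    simpa [hv] using hz
  · right
    rw [eventually_nhdsWithin_iff] at h ⊢
    have := ht.eventually h
    filter_upwards [this] with z hz hzc
    have h' := hz (sub_ne_zero.2 hzc)
    simpa [hv] using h'

end Literature.Analysis.Complex

end
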